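import Literature.NumberTheory.Automorphic.Liu2021.AppendixC.RestOneLevelInvariantsHom
import Literature.NumberTheory.Automorphic.Liu2021.AppendixC.AlbaneseFiniteQuotientDescent
import Mathlib.Topology.Algebra.OpenSubgroup
import HarnessLib

/-!
# [Liu2021, Thm. 4.18 (1)] input (D): descent up to isogeny of `K`-invariant homomorphisms on `A_N = Alb(X_N)`, from the level
# quotient property `X_K = X_N/(K/N)` and the Albanese trace of a finite quotient

[Liu2021] = Yifeng Liu, *Fourier–Jacobi cycles and arithmetic relative trace formula*, Camb. J. Math. **9** (2021).  PROOF FILE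
(one theorem; no definition, no named fact, no instance).  Cell hodgecm-mathlib, INVENTORY row VI-4 `HonestIsogenyDescent`: the
predicate `Sec42Data.HeckeTranslates.IsogenyDescent` (`AppendixC/RestOneLevelInvariantsHom.lean`) — «a `K`-invariant homomorphism
`φ : A_N ⟶ B` has `Alb_{u^N_K} ≫ ψ = m·φ` for some `ψ : A_K ⟶ B`, `m ≠ 0`» — is PROVED for every §4.2 datum `C` with Hecke
translates `T` whose transition morphisms `u^N_K : X_N ⟶ X_K` (`N ≤ K` normal, sufficiently small) are QUOTIENTS of `X_N` by
the translates `T_k`, `k ∈ K`, for separated test objects ([Milne2005ShimuraVarieties] Rem. 5.29 (c) «the variety `S_K` is the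
quotient of `S_{K′}` by the action of `K/K′`»; [Deligne1979ShimuraVarieties] 2.7.1), GRANTED the Albanese trace of a finite
quotient (`AlbaneseTraceOfFiniteQuotient`, [Lang1983AbelianVarieties] VIII §6).

PROOF.  `K` is compact and `N ≤ K` open, so `Δ := K/N` is a finite group (Mathlib `Subgroup.quotient_finite_of_isOpen`); it acts
on `X_N` by the automorphisms `k ↦ T_{k⁻¹}` (the laws `T_g ≫ T_{g'} = T_{gg'}`, `T_k = 𝟙 (k ∈ N)` of `Sec42Data.HeckeTranslates`),
`u^N_K` is invariant (`T_k ≫ u = T_k ≫ T_1 = T_k = T_1 ≫ T_k = u`) and, by hypothesis, a quotient for separated test objects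
(`Motives.IsSepQuotient`); `X_N`, `X_K` are smooth projective over the number field `E` ([Liu2021] §4.2 l. 2064, the fields
`smooth_X`/`projective_X` of `CompactifiedSystem`); so `Albanese.exists_map_comp_eq_zsmul_of_isSepQuotient`
(`AppendixC/AlbaneseFiniteQuotientDescent.lean`) applies to `Alb_{u^N_K} = Albanese.map` (`Sec42Data.Atr_eq_map`) and the
`Δ`-invariant `φ` (`Alb(T_k) = T.albTr k`), with `m = [K : N]`.  HC_CM is proved only modulo the 7 printed citations until rung 0
closes; this file discharges nothing by itself (two hypotheses: the level quotient property and the Albanese trace).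
-/

set_option autoImplicit false

noncomputable section

open CategoryTheory AlgebraicGeometry NumberField
open Literature.AlgebraicGeometry.Motives (SchemeOver AbelianVariety IsProjectiveOver IsSepQuotient)

namespace Literature.NumberTheory.Automorphic.Liu2021.AppendixC

variable {F E : Type} [Field F] [NumberField F] [IsTotallyReal F] [Field E] [NumberField E] [Algebra F E]
  [IsTotallyComplex E] [Algebra.IsQuadraticExtension F E]
variable {P5 : PropC5Data F E} {isotropicAt : ℕ → Prop}

/-- **Input (D) of [Liu2021, Thm. 4.18 (1)] from the level quotient property.**  Let `C` be a §4.2 datum with Hecke translates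
`T`, and suppose that for all sufficiently small levels `N ≤ K` with `N` normal in `K` the transition morphism
`u^N_K : X_N ⟶ X_K` is a quotient of `X_N` by the translates `T_k : X_N ⟶ X_N` (`k ∈ K`) for separated test objects: every
`E`-morphism `X_N ⟶ W` (`W` separated) invariant under all `T_k` factors uniquely through `u^N_K`
([Milne2005ShimuraVarieties] Rem. 5.29 (c); [Deligne1979ShimuraVarieties] 2.7.1).  Then, granted the Albanese trace of a finite
quotient ([Lang1983AbelianVarieties] Ch. VIII §6), `T.IsogenyDescent` holds: every homomorphism `φ : A_N ⟶ B` with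
`Alb(T_k) ≫ φ = φ` (`k ∈ K`) satisfies `Alb_{u^N_K} ≫ ψ = m • φ` for some `ψ : A_K ⟶ B` and `m ≠ 0` (`m = [K : N]`).
[cite: Liu2021, Thm. 4.18 (1) FJcycle.tex l. 2239 and §4.2 l. 2064–2074] [cite: Milne2005ShimuraVarieties, Rem. 5.29 (c) p. 65]
[cite: Lang1983AbelianVarieties, Ch. VIII §6 Thm. 13, pp. 224–227] -/
theorem Sec42Data.HeckeTranslates.isogenyDescent_of_levelQuotient {C : Sec42Data P5 isotropicAt}
    (T : C.HeckeTranslates) (hAT : AlbaneseTraceOfFiniteQuotient.{0})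
    (hq : ∀ ⦃N K : C5.SmallLevel C.S.K₀⦄ (h : N ≤ K) (hn : ∀ k ∈ K.1.1, C5.HeckeLE k N N)
      (W : SchemeOver E) (f : C.X N ⟶ W), IsSeparated W.hom →
      (∀ (k : C.G) (hk : k ∈ K.1.1), T.tr k N N (hn k hk) ≫ f = f) →
      ∃! fbar : C.X K ⟶ W, C.cpt.X.map (homOfLE h) ≫ fbar = f) :
    T.IsogenyDescent := by
  intro N K h hn B φ hφ
  classical
  -- the compact group `K`, its open normal subgroup `N`, and the finite group `Δ = K/N`
  let Kg : Subgroup C.G := K.1.1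
  let Ng : Subgroup Kg := N.1.1.subgroupOf K.1.1
  have hmemNg : ∀ x : Kg, x ∈ Ng ↔ (x : C.G) ∈ N.1.1 := fun x => Subgroup.mem_subgroupOf
  haveI hNn : Ng.Normal := ⟨fun n hn' g => by
    rw [hmemNg] at hn' ⊢
    have h1 := hn (g⁻¹ : Kg) (g⁻¹).2 (n : C.G) hn'
    simpa only [Subgroup.coe_inv, inv_inv, Subgroup.coe_mul] using h1⟩
  haveI : CompactSpace Kg := isCompact_iff_compactSpace.1 K.1.2.2
  have hNo : IsOpen (Ng : Set Kg) := N.1.2.1.preimage continuous_subtype_val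
  haveI : Finite (Kg ⧸ Ng) := Subgroup.quotient_finite_of_isOpen Ng hNo
  letI : Fintype (Kg ⧸ Ng) := Fintype.ofFinite _
  -- the translates `T_k`, `k ∈ K`, as automorphisms of `X_N`
  have hinv : ∀ {k : C.G}, k ∈ K.1.1 → k⁻¹ ∈ K.1.1 := fun hk => K.1.1.inv_mem hk
  have htr1 : ∀ (g : C.G) (hg : g = 1) (hh : C5.HeckeLE g N N), T.tr g N N hh = 𝟙 (C.X N) := by
    rintro g rfl hh
    exact T.tr_self N.1.1.one_mem
  let trI : ∀ k : C.G, k ∈ K.1.1 → (C.X N ≅ C.X N) := fun k hk =>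
    { hom := T.tr k N N (hn k hk)
      inv := T.tr k⁻¹ N N (hn k⁻¹ (hinv hk))
      hom_inv_id := by rw [T.tr_mul]; exact htr1 _ (mul_inv_cancel k) _
      inv_hom_id := by rw [T.tr_mul]; exact htr1 _ (inv_mul_cancel k) _ }
  have trI_hom : ∀ (k : C.G) (hk : k ∈ K.1.1), (trI k hk).hom = T.tr k N N (hn k hk) := fun _ _ => rfl
  -- the action `k ↦ T_{k⁻¹}` of `K` on `X_N` (a homomorphism into `Aut X_N`, whose multiplication is reversed composition)
  let actK : Kg →* Aut (C.X N) :=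
    { toFun := fun k => trI ((k : C.G)⁻¹) (hinv k.2)
      map_one' := Iso.ext (by
        change T.tr ((1 : Kg) : C.G)⁻¹ N N _ = 𝟙 (C.X N)
        exact htr1 _ (by simp) _)
      map_mul' := fun a b => Iso.ext (by
        change T.tr ((a : C.G) * b)⁻¹ N N _ = T.tr (b : C.G)⁻¹ N N _ ≫ T.tr (a : C.G)⁻¹ N N _
        rw [T.tr_mul]
        exact T.tr_congr (mul_inv_rev _ _) _ _) }
  have actK_hom : ∀ k : Kg, (actK k).hom = T.tr (k : C.G)⁻¹ N N (hn _ (hinv k.2)) := fun _ => rfl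
  -- it is trivial on `N`, hence descends to `Δ = K/N`
  have hker : ∀ n ∈ Ng, actK n = 1 := fun n hn' => Iso.ext (by
    rw [actK_hom]
    exact T.tr_self (N.1.1.inv_mem ((hmemNg n).1 hn')))
  let act : (Kg ⧸ Ng) →* Aut (C.X N) := QuotientGroup.lift Ng actK hker
  have act_mk : ∀ k : Kg, (act (QuotientGroup.mk k)).hom = T.tr (k : C.G)⁻¹ N N (hn _ (hinv k.2)) := fun _ => rfl
  -- `u^N_K` is a quotient of `X_N` by this action for separated test objects
  have hu : C.cpt.X.map (homOfLE h) = T.tr 1 N K (C5.HeckeLE.one_of_le h) := (T.tr_one (homOfLE h)).symm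
  have hp : IsSepQuotient (fun g => act g) (C.cpt.X.map (homOfLE h)) := by
    refine ⟨fun g => ?_, fun W f hW hf => hq h hn W f hW fun k hk => ?_⟩
    · obtain ⟨k, rfl⟩ := QuotientGroup.mk_surjective g
      rw [act_mk, hu, T.tr_mul]
      conv_rhs => rw [← Category.comp_id (T.tr 1 N K _), ← T.tr_self (K := K) (hinv k.2), T.tr_mul]
      exact T.tr_congr (by simp) _ _
    · have h1 := hf (QuotientGroup.mk ⟨k⁻¹, hinv hk⟩)
      rw [act_mk] at h1
      rw [T.tr_congr (inv_inv k).symm (hn k hk) (hn _ (hinv (hinv hk)))]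
      exact h1
  -- the invariance of `φ` under the action, through `Alb`
  have hφ' : ∀ g : Kg ⧸ Ng, (C.alb N).map (C.alb N) (act g).hom ≫ φ = φ := by
    intro g
    obtain ⟨k, rfl⟩ := QuotientGroup.mk_surjective g
    rw [act_mk]
    exact hφ (k : C.G)⁻¹ (hinv k.2)
  -- conclude by the descent along the finite quotient
  haveI := C.cpt.smooth_X N
  haveI := C.cpt.smooth_X K
  obtain ⟨m, ψ, hm, hψ⟩ := Albanese.exists_map_comp_eq_zsmul_of_isSepQuotient hAT (dX := P5.n - 1) (dY := P5.n - 1)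
    (C.cpt.projective_X N) (C.cpt.projective_X K) act (C.cpt.X.map (homOfLE h)) hp (C.alb N) (C.alb K) φ hφ'
  refine ⟨m, ψ, hm, ?_⟩
  rw [C.Atr_eq_map (homOfLE h)]
  exact hψ

/-- **Input (D) from the level quotient property and the Albanese trace AT THE DATUM'S FIELD `E` ONLY** — the same theorem as
`isogenyDescent_of_levelQuotient`, with the universally quantified named fact `AlbaneseTraceOfFiniteQuotient.{0}` (all fields of
characteristic zero in `Type`) replaced by its instance at the single field `E` of the §4.2 datum (the shape in which the trace is
PROVED for fields embedded in `ℂ`: the cocycle/`∇`-descent chain of `AppendixC/AlbaneseCocycle.lean`,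
`AlbaneseTraceExtension.lean`, `Motives/FiniteQuotientProductDescent.lean`).  Re-threading only; the proof is that of
`isogenyDescent_of_levelQuotient` with the last step through `Albanese.exists_map_comp_eq_zsmul_of_trace`.
[cite: Liu2021, Thm. 4.18 (1) FJcycle.tex l. 2239 and §4.2 l. 2064–2074] [cite: Milne2005ShimuraVarieties, Rem. 5.29 (c) p. 65]
[cite: Lang1983AbelianVarieties, Ch. VIII §6 Thm. 13, pp. 224–227] -/
theorem Sec42Data.HeckeTranslates.isogenyDescent_of_levelQuotient_of_trace {C : Sec42Data P5 isotropicAt}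
    (T : C.HeckeTranslates)
    (hAT : ∀ (X Y : SchemeOver E) (dX dY : ℕ)
      [SmoothOfRelativeDimension dX X.hom] [SmoothOfRelativeDimension dY Y.hom],
      IsProjectiveOver X → IsProjectiveOver Y →
      ∀ (Δ : Type) [Group Δ] [Fintype Δ] (act : Δ →* Aut X) (p : X ⟶ Y),
        IsSepQuotient (fun g => act g) p →
        ∀ (aX : Albanese X) (aY : Albanese Y),
          ∃ t : aY.Alb ⟶ aX.Alb, aX.map aY p ≫ t = ∑ g : Δ, aX.map aX (act g).hom)
    (hq : ∀ ⦃N K : C5.SmallLevel C.S.K₀⦄ (h : N ≤ K) (hn : ∀ k ∈ K.1.1, C5.HeckeLE k N N)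
      (W : SchemeOver E) (f : C.X N ⟶ W), IsSeparated W.hom →
      (∀ (k : C.G) (hk : k ∈ K.1.1), T.tr k N N (hn k hk) ≫ f = f) →
      ∃! fbar : C.X K ⟶ W, C.cpt.X.map (homOfLE h) ≫ fbar = f) :
    T.IsogenyDescent := by
  intro N K h hn B φ hφ
  classical
  -- the compact group `K`, its open normal subgroup `N`, and the finite group `Δ = K/N`
  let Kg : Subgroup C.G := K.1.1
  let Ng : Subgroup Kg := N.1.1.subgroupOf K.1.1
  have hmemNg : ∀ x : Kg, x ∈ Ng ↔ (x : C.G) ∈ N.1.1 := fun x => Subgroup.mem_subgroupOf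
  haveI hNn : Ng.Normal := ⟨fun n hn' g => by
    rw [hmemNg] at hn' ⊢
    have h1 := hn (g⁻¹ : Kg) (g⁻¹).2 (n : C.G) hn'
    simpa only [Subgroup.coe_inv, inv_inv, Subgroup.coe_mul] using h1⟩
  haveI : CompactSpace Kg := isCompact_iff_compactSpace.1 K.1.2.2
  have hNo : IsOpen (Ng : Set Kg) := N.1.2.1.preimage continuous_subtype_val
  haveI : Finite (Kg ⧸ Ng) := Subgroup.quotient_finite_of_isOpen Ng hNo
  letI : Fintype (Kg ⧸ Ng) := Fintype.ofFinite _
  -- the translates `T_k`, `k ∈ K`, as automorphisms of `X_N`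
  have hinv : ∀ {k : C.G}, k ∈ K.1.1 → k⁻¹ ∈ K.1.1 := fun hk => K.1.1.inv_mem hk
  have htr1 : ∀ (g : C.G) (hg : g = 1) (hh : C5.HeckeLE g N N), T.tr g N N hh = 𝟙 (C.X N) := by
    rintro g rfl hh
    exact T.tr_self N.1.1.one_mem
  let trI : ∀ k : C.G, k ∈ K.1.1 → (C.X N ≅ C.X N) := fun k hk =>
    { hom := T.tr k N N (hn k hk)
      inv := T.tr k⁻¹ N N (hn k⁻¹ (hinv hk))
      hom_inv_id := by rw [T.tr_mul]; exact htr1 _ (mul_inv_cancel k) _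
      inv_hom_id := by rw [T.tr_mul]; exact htr1 _ (inv_mul_cancel k) _ }
  -- the action `k ↦ T_{k⁻¹}` of `K` on `X_N`
  let actK : Kg →* Aut (C.X N) :=
    { toFun := fun k => trI ((k : C.G)⁻¹) (hinv k.2)
      map_one' := Iso.ext (by
        change T.tr ((1 : Kg) : C.G)⁻¹ N N _ = 𝟙 (C.X N)
        exact htr1 _ (by simp) _)
      map_mul' := fun a b => Iso.ext (by
        change T.tr ((a : C.G) * b)⁻¹ N N _ = T.tr (b : C.G)⁻¹ N N _ ≫ T.tr (a : C.G)⁻¹ N N _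
        rw [T.tr_mul]
        exact T.tr_congr (mul_inv_rev _ _) _ _) }
  have actK_hom : ∀ k : Kg, (actK k).hom = T.tr (k : C.G)⁻¹ N N (hn _ (hinv k.2)) := fun _ => rfl
  -- it is trivial on `N`, hence descends to `Δ = K/N`
  have hker : ∀ n ∈ Ng, actK n = 1 := fun n hn' => Iso.ext (by
    rw [actK_hom]
    exact T.tr_self (N.1.1.inv_mem ((hmemNg n).1 hn')))
  let act : (Kg ⧸ Ng) →* Aut (C.X N) := QuotientGroup.lift Ng actK hker
  have act_mk : ∀ k : Kg, (act (QuotientGroup.mk k)).hom = T.tr (k : C.G)⁻¹ N N (hn _ (hinv k.2)) := fun _ => rfl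
  -- `u^N_K` is a quotient of `X_N` by this action for separated test objects
  have hu : C.cpt.X.map (homOfLE h) = T.tr 1 N K (C5.HeckeLE.one_of_le h) := (T.tr_one (homOfLE h)).symm
  have hp : IsSepQuotient (fun g => act g) (C.cpt.X.map (homOfLE h)) := by
    refine ⟨fun g => ?_, fun W f hW hf => hq h hn W f hW fun k hk => ?_⟩
    · obtain ⟨k, rfl⟩ := QuotientGroup.mk_surjective g
      rw [act_mk, hu, T.tr_mul]
      conv_rhs => rw [← Category.comp_id (T.tr 1 N K _), ← T.tr_self (K := K) (hinv k.2), T.tr_mul]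
      exact T.tr_congr (by simp) _ _
    · have h1 := hf (QuotientGroup.mk ⟨k⁻¹, hinv hk⟩)
      rw [act_mk] at h1
      rw [T.tr_congr (inv_inv k).symm (hn k hk) (hn _ (hinv (hinv hk)))]
      exact h1
  -- the invariance of `φ` under the action, through `Alb`
  have hφ' : ∀ g : Kg ⧸ Ng, (C.alb N).map (C.alb N) (act g).hom ≫ φ = φ := by
    intro g
    obtain ⟨k, rfl⟩ := QuotientGroup.mk_surjective g
    rw [act_mk]
    exact hφ (k : C.G)⁻¹ (hinv k.2)
  -- conclude by the trace at `E` and the descent along the finite quotient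
  haveI := C.cpt.smooth_X N
  haveI := C.cpt.smooth_X K
  obtain ⟨t, ht⟩ := hAT (C.X N) (C.X K) (P5.n - 1) (P5.n - 1) (C.cpt.projective_X N) (C.cpt.projective_X K)
    (Kg ⧸ Ng) act (C.cpt.X.map (homOfLE h)) hp (C.alb N) (C.alb K)
  obtain ⟨m, ψ, hm, hψ⟩ := Albanese.exists_map_comp_eq_zsmul_of_trace (C.alb N) (C.alb K)
    (fun g => (C.alb N).map (C.alb N) (act g).hom) (C.cpt.X.map (homOfLE h)) t ht φ hφ'
  refine ⟨m, ψ, hm, ?_⟩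
  rw [C.Atr_eq_map (homOfLE h)]
  exact hψ

end Literature.NumberTheory.Automorphic.Liu2021.AppendixC

end
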